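import Literature.NumberTheory.EllipticCurves.FormalGroupXDerivativeProofs
import HarnessLib

/-!
# The invariant derivatives of `x(z)`, read in the variables of `R⟦u, v⟧` (proofs only)

Trunk T-NT-EC (Literature/NumberTheory/EllipticCurves). Pure proof file on the way to the formal
Mazur–Tate theta relation (named fact `WeierstrassCurve.padicSigma_theta_formal`,
`CanonicalPAdicHeightThetaProofs.lean`): the one-variable identities of
`FormalGroupXDerivativeProofs.lean` (`z·DX = 2ηX + Ỹ`, its `D`-derivative
`z·D(DX) = 2(Dη)X + η·DX + DỸ`, `z·DỸ = 3ηỸ + 6X² + b₂z²X + b₄z⁴`, `Ỹ² = 4X³ + ⋯`,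
`X²·Dξ = -zỸ`, `X³·D²ξ = ⋯`, `ξ·X = z²`) transported to `R⟦u, v⟧` along the substitution
homomorphism `h ↦ h(Xᵢ)` (`PowerSeries.subst (MvPowerSeries.X i)`), in the syntactic shape used by
the Step-A computation of the theta relation (`CanonicalPAdicHeightThetaLogDerivProofs.lean`).

## Sources

* C. Blakestad, D. Grant, J. Number Theory 249 (2023) (arXiv:1903.02480), §3 Lemma 10, Prop. 14.

## Design notes

Bookkeeping only; no definitions, no named facts.
-/

noncomputable section

open PowerSeries Literature.NumberTheory.EllipticCurves

namespace WeierstrassCurve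

/-! ### Reading one-variable identities in the variable `u` (or `v`) -/

section Read

variable {A : Type*} [CommRing A] (V : WeierstrassCurve A)

/-- `(2ηX + Ỹ)(Xᵢ)`-type transport: reading `z·D(X) = 2ηX + Ỹ` in the variable `Xᵢ`. [folklore] -/
theorem read_X_mul_D_formalXMulSq (i : Fin 2) :
    (MvPowerSeries.X i : MvPowerSeries (Fin 2) A) *
        (V.formalInvariantDerivation V.formalXMulSq).subst (MvPowerSeries.X i : MvPowerSeries (Fin 2) A) =
      2 * V.formalEta.subst (MvPowerSeries.X i : MvPowerSeries (Fin 2) A) *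
          V.formalXMulSq.subst (MvPowerSeries.X i : MvPowerSeries (Fin 2) A) +
        ((MvPowerSeries.C V.a₁ * MvPowerSeries.X i - 2) *
            V.formalXMulSq.subst (MvPowerSeries.X i : MvPowerSeries (Fin 2) A) +
          MvPowerSeries.C V.a₃ * (MvPowerSeries.X i) ^ 3) := by
  have hs : PowerSeries.HasSubst (MvPowerSeries.X i : MvPowerSeries (Fin 2) A) := PowerSeries.HasSubst.X i
  have h := congrArg (PowerSeries.subst (MvPowerSeries.X i : MvPowerSeries (Fin 2) A))
    V.X_mul_formalInvariantDerivation_formalXMulSq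
  simp only [← PowerSeries.coe_substAlgHom hs, map_add, map_sub, map_mul, map_pow, map_ofNat,
    PowerSeries.substAlgHom_X] at h
  simpa only [PowerSeries.coe_substAlgHom hs, PowerSeries.subst_C] using h

/-- Reading `z·D(DX) = 2(Dη)X + η·DX + DỸ` (the derivative of `z·DX = 2ηX + Ỹ`) in `Xᵢ`. [folklore] -/
theorem read_X_mul_D_D_formalXMulSq (i : Fin 2) :
    (MvPowerSeries.X i : MvPowerSeries (Fin 2) A) *
        (V.formalInvariantDerivation (V.formalInvariantDerivation V.formalXMulSq)).subst
          (MvPowerSeries.X i : MvPowerSeries (Fin 2) A) =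
      2 * (V.formalInvariantDerivation V.formalEta).subst (MvPowerSeries.X i : MvPowerSeries (Fin 2) A) *
          V.formalXMulSq.subst (MvPowerSeries.X i : MvPowerSeries (Fin 2) A) +
        V.formalEta.subst (MvPowerSeries.X i : MvPowerSeries (Fin 2) A) *
          (V.formalInvariantDerivation V.formalXMulSq).subst (MvPowerSeries.X i : MvPowerSeries (Fin 2) A) +
        (V.formalInvariantDerivation ((C V.a₁ * X - 2) * V.formalXMulSq + C V.a₃ * X ^ 3)).subst
          (MvPowerSeries.X i : MvPowerSeries (Fin 2) A) := by
  have hs : PowerSeries.HasSubst (MvPowerSeries.X i : MvPowerSeries (Fin 2) A) := PowerSeries.HasSubst.X i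
  -- differentiate `z·DX = 2ηX + Ỹ` along `D`
  have hD2 : V.formalInvariantDerivation (2 : A⟦X⟧) = 0 := Derivation.map_natCast _ 2
  set DY := V.formalInvariantDerivation ((C V.a₁ * X - 2) * V.formalXMulSq + C V.a₃ * X ^ 3) with hDY
  have h1 := congrArg V.formalInvariantDerivation V.X_mul_formalInvariantDerivation_formalXMulSq
  rw [map_add, ← hDY] at h1
  simp only [Derivation.leibniz, smul_eq_mul, formalInvariantDerivation_X, hD2, mul_zero, add_zero] at h1
  -- `h1 : z·D(DX) + DX·η = 2·(η·DX + X·Dη) + DỸ`; solve for `z·D(DX)` and read in `Xᵢ`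
  have h2 : X * V.formalInvariantDerivation (V.formalInvariantDerivation V.formalXMulSq) =
      2 * V.formalInvariantDerivation V.formalEta * V.formalXMulSq +
        V.formalEta * V.formalInvariantDerivation V.formalXMulSq + DY := by
    linear_combination h1
  have h := congrArg (PowerSeries.subst (MvPowerSeries.X i : MvPowerSeries (Fin 2) A)) h2
  simp only [← PowerSeries.coe_substAlgHom hs, map_add, map_mul, map_ofNat, PowerSeries.substAlgHom_X] at h
  simpa only [PowerSeries.coe_substAlgHom hs] using h

/-- Reading `z·D(Ỹ) = 3ηỸ + 6X² + b₂z²X + b₄z⁴` in `Xᵢ`. [folklore] -/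
theorem read_X_mul_D_formalYTilde (i : Fin 2) :
    (MvPowerSeries.X i : MvPowerSeries (Fin 2) A) *
        (V.formalInvariantDerivation ((C V.a₁ * X - 2) * V.formalXMulSq + C V.a₃ * X ^ 3)).subst
          (MvPowerSeries.X i : MvPowerSeries (Fin 2) A) =
      3 * V.formalEta.subst (MvPowerSeries.X i : MvPowerSeries (Fin 2) A) *
          ((MvPowerSeries.C V.a₁ * MvPowerSeries.X i - 2) *
              V.formalXMulSq.subst (MvPowerSeries.X i : MvPowerSeries (Fin 2) A) +
            MvPowerSeries.C V.a₃ * (MvPowerSeries.X i) ^ 3) +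
        6 * V.formalXMulSq.subst (MvPowerSeries.X i : MvPowerSeries (Fin 2) A) ^ 2 +
        MvPowerSeries.C V.b₂ * (MvPowerSeries.X i) ^ 2 *
          V.formalXMulSq.subst (MvPowerSeries.X i : MvPowerSeries (Fin 2) A) +
        MvPowerSeries.C V.b₄ * (MvPowerSeries.X i) ^ 4 := by
  have hs : PowerSeries.HasSubst (MvPowerSeries.X i : MvPowerSeries (Fin 2) A) := PowerSeries.HasSubst.X i
  set DY := V.formalInvariantDerivation ((C V.a₁ * X - 2) * V.formalXMulSq + C V.a₃ * X ^ 3) with hDY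
  have h := congrArg (PowerSeries.subst (MvPowerSeries.X i : MvPowerSeries (Fin 2) A))
    V.X_mul_formalInvariantDerivation_formalYTilde
  rw [← hDY] at h
  simp only [← PowerSeries.coe_substAlgHom hs, map_add, map_sub, map_mul, map_pow, map_ofNat,
    PowerSeries.substAlgHom_X] at h
  simpa only [PowerSeries.coe_substAlgHom hs, PowerSeries.subst_C] using h

/-- Reading `Ỹ² = 4X³ + b₂z²X² + 2b₄z⁴X + b₆z⁶` in `Xᵢ`. [folklore] -/
theorem read_formalYTilde_sq (i : Fin 2) :
    ((MvPowerSeries.C V.a₁ * MvPowerSeries.X i - 2) *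
          V.formalXMulSq.subst (MvPowerSeries.X i : MvPowerSeries (Fin 2) A) +
        MvPowerSeries.C V.a₃ * (MvPowerSeries.X i) ^ 3) ^ 2 =
      4 * V.formalXMulSq.subst (MvPowerSeries.X i : MvPowerSeries (Fin 2) A) ^ 3 +
        MvPowerSeries.C V.b₂ * (MvPowerSeries.X i) ^ 2 *
          V.formalXMulSq.subst (MvPowerSeries.X i : MvPowerSeries (Fin 2) A) ^ 2 +
        2 * MvPowerSeries.C V.b₄ * (MvPowerSeries.X i) ^ 4 *
          V.formalXMulSq.subst (MvPowerSeries.X i : MvPowerSeries (Fin 2) A) +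
        MvPowerSeries.C V.b₆ * (MvPowerSeries.X i) ^ 6 := by
  have hs : PowerSeries.HasSubst (MvPowerSeries.X i : MvPowerSeries (Fin 2) A) := PowerSeries.HasSubst.X i
  have h := congrArg (PowerSeries.subst (MvPowerSeries.X i : MvPowerSeries (Fin 2) A)) V.formalYTilde_sq
  simp only [← PowerSeries.coe_substAlgHom hs, map_add, map_sub, map_mul, map_pow, map_ofNat,
    PowerSeries.substAlgHom_X] at h
  simpa only [PowerSeries.coe_substAlgHom hs, PowerSeries.subst_C] using h

/-- Reading `X²·Dξ = -zỸ` (`ξ = z²B = 1/x`) in `Xᵢ`. [folklore] -/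
theorem read_formalXMulSq_sq_mul_D_xInv (i : Fin 2) :
    V.formalXMulSq.subst (MvPowerSeries.X i : MvPowerSeries (Fin 2) A) ^ 2 *
        (V.formalInvariantDerivation (X ^ 2 * V.formalWDivCube)).subst
          (MvPowerSeries.X i : MvPowerSeries (Fin 2) A) =
      -((MvPowerSeries.X i : MvPowerSeries (Fin 2) A) *
        ((MvPowerSeries.C V.a₁ * MvPowerSeries.X i - 2) *
            V.formalXMulSq.subst (MvPowerSeries.X i : MvPowerSeries (Fin 2) A) +
          MvPowerSeries.C V.a₃ * (MvPowerSeries.X i) ^ 3)) := by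
  have hs : PowerSeries.HasSubst (MvPowerSeries.X i : MvPowerSeries (Fin 2) A) := PowerSeries.HasSubst.X i
  have h := congrArg (PowerSeries.subst (MvPowerSeries.X i : MvPowerSeries (Fin 2) A))
    V.formalXMulSq_sq_mul_formalInvariantDerivation_xInv
  simp only [← PowerSeries.coe_substAlgHom hs, map_add, map_sub, map_mul, map_pow, map_ofNat, map_neg,
    PowerSeries.substAlgHom_X] at h
  simpa only [PowerSeries.coe_substAlgHom hs, PowerSeries.subst_C] using h

/-- Reading `X³·D²ξ = 2Ỹ² - X(6X² + b₂z²X + b₄z⁴)` in `Xᵢ`. [folklore] -/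
theorem read_formalXMulSq_cube_mul_D_D_xInv (i : Fin 2) :
    V.formalXMulSq.subst (MvPowerSeries.X i : MvPowerSeries (Fin 2) A) ^ 3 *
        (V.formalInvariantDerivation (V.formalInvariantDerivation (X ^ 2 * V.formalWDivCube))).subst
          (MvPowerSeries.X i : MvPowerSeries (Fin 2) A) =
      2 * ((MvPowerSeries.C V.a₁ * MvPowerSeries.X i - 2) *
              V.formalXMulSq.subst (MvPowerSeries.X i : MvPowerSeries (Fin 2) A) +
            MvPowerSeries.C V.a₃ * (MvPowerSeries.X i) ^ 3) ^ 2 -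
        V.formalXMulSq.subst (MvPowerSeries.X i : MvPowerSeries (Fin 2) A) *
          (6 * V.formalXMulSq.subst (MvPowerSeries.X i : MvPowerSeries (Fin 2) A) ^ 2 +
            MvPowerSeries.C V.b₂ * (MvPowerSeries.X i) ^ 2 *
              V.formalXMulSq.subst (MvPowerSeries.X i : MvPowerSeries (Fin 2) A) +
            MvPowerSeries.C V.b₄ * (MvPowerSeries.X i) ^ 4) := by
  have hs : PowerSeries.HasSubst (MvPowerSeries.X i : MvPowerSeries (Fin 2) A) := PowerSeries.HasSubst.X i
  have h := congrArg (PowerSeries.subst (MvPowerSeries.X i : MvPowerSeries (Fin 2) A))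
    V.formalXMulSq_cube_mul_formalInvariantDerivation_sq_xInv
  simp only [← PowerSeries.coe_substAlgHom hs, map_add, map_sub, map_mul, map_pow, map_ofNat,
    PowerSeries.substAlgHom_X] at h
  simpa only [PowerSeries.coe_substAlgHom hs, PowerSeries.subst_C] using h

/-- Reading `ξ·X = z²` (`ξ = z²B`, `BX = 1`) in `Xᵢ`. [folklore] -/
theorem read_xInv_mul_formalXMulSq (i : Fin 2) :
    (X ^ 2 * V.formalWDivCube).subst (MvPowerSeries.X i : MvPowerSeries (Fin 2) A) *
        V.formalXMulSq.subst (MvPowerSeries.X i : MvPowerSeries (Fin 2) A) =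
      (MvPowerSeries.X i : MvPowerSeries (Fin 2) A) ^ 2 := by
  have hs : PowerSeries.HasSubst (MvPowerSeries.X i : MvPowerSeries (Fin 2) A) := PowerSeries.HasSubst.X i
  have h1 : X ^ 2 * V.formalWDivCube * V.formalXMulSq = X ^ 2 := by
    rw [mul_assoc, V.formalWDivCube_mul_formalXMulSq, mul_one]
  have h := congrArg (PowerSeries.subst (MvPowerSeries.X i : MvPowerSeries (Fin 2) A)) h1
  rw [PowerSeries.subst_mul hs, PowerSeries.subst_pow hs, PowerSeries.subst_X hs] at h
  exact h

end Read

end WeierstrassCurve
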